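import Literature.NumberTheory.LFunctions.FeketePolyaKernelCertificatesBlockWrappers
import HarnessLib

/-!
# No real zero for real primitive characters of conductor `6140 ≤ q ≤ 7751`: the Fekete–Pólya rows, in the kernel (rows deferred by the earlier engines)

Topic `Literature/NumberTheory/LFunctions`; namespace `Literature.NumberTheory.LFunctions`. THEOREMS only (no
definition, no named fact, no `sorry`; standard axioms): one PUBLIC theorem **`noRealZero{Odd,Even}_fp_<q>`** per
fundamental discriminant `D`, `|D| = q ∈ [6140, 7751]`, that admits a Fekete–Pólya witness but was DEFERRED by the per-position engines v1/v2 (walk too long for one `decide`) — for every primitive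
quadratic `χ` mod `q` of the parity of `D` and every `σ ∈ (0, 1)`, `L(σ, χ) ≠ 0` (statement shape of the
`interval_cases` bullets of the `NoRealZero{Odd,Even}…` range files, so a range assembly cites them by name).
Cell `parity-realchar`, kernel floor of the wide column (TARGET §2 row 19), Fekete–Pólya lane (seat prover-2).

Method (engine v4): `FeketePolyaKernelCertificatesBlock{,Wrappers}.lean` — the iterated partial sums of order
`K` of the induced character `χ↑(q·w)` are non-negative over one period, decided in the kernel BLOCKWISE on packed
base-`2^b` digits (`blockCert b B K (q·w) (tabs… b ps q w)`: sign tables of the character from the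
quadratic-residue bitsets of the prime factors of the conductor — the factor list is part of each certificate,
primality by `norm_num` — prefix sums by one big-integer multiplication per order and block, sign test by one
AND), hence `ℜL(σ, χ↑(q·w)) > 0` (Fekete–Pólya 1912 / MV §11.2.1 Exercise 7) and `L(σ, χ) ≠ 0` (positive Euler
factors, Exercise 8).  Witnesses `(w, K)` = the cheapest in the exact integer scan of this seat
(`HOME/parity-realchar-prover-2/fp-witnesses-*.tsv`; no kit); the digit width `b` is two bits above the size of
the running-sum bound recorded by the scan.  14 characters in this file (est. 77 kernel-s).
NOT covered here (no Fekete–Pólya witness with `w ≤ 40`, `q·w ≤ 4·10⁵`, `K ≤ 12`; the other Fekete–Pólya rows of this range are in the `NoRealZeroFeketePolyaX…` files) — left to the truncation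
certificates of the companion lane: see those files.

## References

* H. L. Montgomery, R. C. Vaughan, *Multiplicative Number Theory I*, CUP 2007, §9.3 Thm 9.13, §11.2.1
  Exercises 7–8. [MontgomeryVaughan2007]
* M. Fekete, G. Pólya, *Über ein Problem von Laguerre*, Rend. Circ. Mat. Palermo 34 (1912) 89–120. [FeketePolya1912]
-/

namespace Literature.NumberTheory.LFunctions

open FeketePolyaKernel

set_option maxHeartbeats 400000 in
/-- `D = 6140`: the even character `χ₋₄·(·/1535)` of conductor `6140` (`1535`: 5 · 307) — Fekete–Pólya witness of order `6` along the induced modulus `6140·33 = 202620`, block certificate (digits of `88` bits, splitting depth `10`); est. `5.9` kernel-s. [cite: MontgomeryVaughan2007, §11.2.1 Exercises 7 (g), 8] -/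
theorem noRealZeroEven_fp_6140 :
    ∀ χ : DirichletCharacter ℂ 6140, χ.IsQuadratic → χ.IsPrimitive → χ.Even →
      ∀ σ : ℝ, 0 < σ → σ < 1 → χ.LFunction σ ≠ 0 :=
  good_even_of_four_blk [5, 307] (by norm_num) (by decide) (by decide) 33 6 88 10 (by decide) (by decide) (by decide)
    (Or.inr (by decide +kernel))

set_option maxHeartbeats 400000 in
/-- `D = -6187`: the odd character `(·/6187)` of conductor `6187` (`6187`: 23 · 269) — Fekete–Pólya witness of order `7` along the induced modulus `6187·30 = 185610`, block certificate (digits of `104` bits, splitting depth `10`); est. `6.7` kernel-s. [cite: MontgomeryVaughan2007, §11.2.1 Exercises 7 (g), 8] -/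
theorem noRealZeroOdd_fp_6187 :
    ∀ χ : DirichletCharacter ℂ 6187, χ.IsQuadratic → χ.IsPrimitive → χ.Odd →
      ∀ σ : ℝ, 0 < σ → σ < 1 → χ.LFunction σ ≠ 0 :=
  good_odd_of_odd_blk [23, 269] (by norm_num) (by decide) (by decide) 30 7 104 10 (by decide) (by decide) (by decide)
    (Or.inr (by decide +kernel))

set_option maxHeartbeats 400000 in
/-- `D = 6632`: the even character `χ₈·(·/829)` of conductor `6632` (`829`: prime) — Fekete–Pólya witness of order `7` along the induced modulus `6632·35 = 232120`, block certificate (digits of `104` bits, splitting depth `10`); est. `8.3` kernel-s. [cite: MontgomeryVaughan2007, §11.2.1 Exercises 7 (g), 8] -/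
theorem noRealZeroEven_fp_6632 :
    ∀ χ : DirichletCharacter ℂ 6632, χ.IsQuadratic → χ.IsPrimitive → χ.Even →
      ∀ σ : ℝ, 0 < σ → σ < 1 → χ.LFunction σ ≠ 0 :=
  good_even_of_eight_blk [829] (by norm_num) (by decide) (by decide) 35 7 104 10 (by decide) (by decide) (by decide)
    (Or.inl (by decide +kernel)) (Or.inr (by decide +kernel))

set_option maxHeartbeats 400000 in
/-- `D = 6668`: the even character `χ₋₄·(·/1667)` of conductor `6668` (`1667`: prime) — Fekete–Pólya witness of order `5` along the induced modulus `6668·33 = 220044`, block certificate (digits of `73` bits, splitting depth `10`); est. `5.3` kernel-s. [cite: MontgomeryVaughan2007, §11.2.1 Exercises 7 (g), 8] -/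
theorem noRealZeroEven_fp_6668 :
    ∀ χ : DirichletCharacter ℂ 6668, χ.IsQuadratic → χ.IsPrimitive → χ.Even →
      ∀ σ : ℝ, 0 < σ → σ < 1 → χ.LFunction σ ≠ 0 :=
  good_even_of_four_blk [1667] (by norm_num) (by decide) (by decide) 33 5 73 10 (by decide) (by decide) (by decide)
    (Or.inr (by decide +kernel))

set_option maxHeartbeats 400000 in
/-- `D = -6807`: the odd character `(·/6807)` of conductor `6807` (`6807`: 3 · 2269) — Fekete–Pólya witness of order `9` along the induced modulus `6807·13 = 88491`, block certificate (digits of `125` bits, splitting depth `9`); est. `4.7` kernel-s. [cite: MontgomeryVaughan2007, §11.2.1 Exercises 7 (g), 8] -/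
theorem noRealZeroOdd_fp_6807 :
    ∀ χ : DirichletCharacter ℂ 6807, χ.IsQuadratic → χ.IsPrimitive → χ.Odd →
      ∀ σ : ℝ, 0 < σ → σ < 1 → χ.LFunction σ ≠ 0 :=
  good_odd_of_odd_blk [3, 2269] (by norm_num) (by decide) (by decide) 13 9 125 9 (by decide) (by decide) (by decide)
    (Or.inr (by decide +kernel))

set_option maxHeartbeats 400000 in
/-- `D = -6916`: the odd character `χ₋₄·(·/1729)` of conductor `6916` (`1729`: 7 · 13 · 19) — Fekete–Pólya witness of order `6` along the induced modulus `6916·17 = 117572`, block certificate (digits of `85` bits, splitting depth `9`); est. `3.4` kernel-s. [cite: MontgomeryVaughan2007, §11.2.1 Exercises 7 (g), 8] -/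
theorem noRealZeroOdd_fp_6916 :
    ∀ χ : DirichletCharacter ℂ 6916, χ.IsQuadratic → χ.IsPrimitive → χ.Odd →
      ∀ σ : ℝ, 0 < σ → σ < 1 → χ.LFunction σ ≠ 0 :=
  good_odd_of_four_blk [7, 13, 19] (by norm_num) (by decide) (by decide) 17 6 85 9 (by decide) (by decide) (by decide)
    (Or.inr (by decide +kernel))

set_option maxHeartbeats 400000 in
/-- `D = -6955`: the odd character `(·/6955)` of conductor `6955` (`6955`: 5 · 13 · 107) — Fekete–Pólya witness of order `6` along the induced modulus `6955·14 = 97370`, block certificate (digits of `84` bits, splitting depth `9`); est. `2.9` kernel-s. [cite: MontgomeryVaughan2007, §11.2.1 Exercises 7 (g), 8] -/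
theorem noRealZeroOdd_fp_6955 :
    ∀ χ : DirichletCharacter ℂ 6955, χ.IsQuadratic → χ.IsPrimitive → χ.Odd →
      ∀ σ : ℝ, 0 < σ → σ < 1 → χ.LFunction σ ≠ 0 :=
  good_odd_of_odd_blk [5, 13, 107] (by norm_num) (by decide) (by decide) 14 6 84 9 (by decide) (by decide) (by decide)
    (Or.inr (by decide +kernel))

set_option maxHeartbeats 400000 in
/-- `D = 7229`: the even character `(·/7229)` of conductor `7229` (`7229`: prime) — Fekete–Pólya witness of order `6` along the induced modulus `7229·21 = 151809`, block certificate (digits of `86` bits, splitting depth `10`); est. `4.8` kernel-s. [cite: MontgomeryVaughan2007, §11.2.1 Exercises 7 (g), 8] -/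
theorem noRealZeroEven_fp_7229 :
    ∀ χ : DirichletCharacter ℂ 7229, χ.IsQuadratic → χ.IsPrimitive → χ.Even →
      ∀ σ : ℝ, 0 < σ → σ < 1 → χ.LFunction σ ≠ 0 :=
  good_even_of_odd_blk [7229] (by norm_num) (by decide) (by decide) 21 6 86 10 (by decide) (by decide) (by decide)
    (Or.inr (by decide +kernel))

set_option maxHeartbeats 400000 in
/-- `D = 7304`: the even character `χ₈·(·/913)` of conductor `7304` (`913`: 11 · 83) — Fekete–Pólya witness of order `6` along the induced modulus `7304·39 = 284856`, block certificate (digits of `91` bits, splitting depth `11`); est. `8.4` kernel-s. [cite: MontgomeryVaughan2007, §11.2.1 Exercises 7 (g), 8] -/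
theorem noRealZeroEven_fp_7304 :
    ∀ χ : DirichletCharacter ℂ 7304, χ.IsQuadratic → χ.IsPrimitive → χ.Even →
      ∀ σ : ℝ, 0 < σ → σ < 1 → χ.LFunction σ ≠ 0 :=
  good_even_of_eight_blk [11, 83] (by norm_num) (by decide) (by decide) 39 6 91 11 (by decide) (by decide) (by decide)
    (Or.inl (by decide +kernel)) (Or.inr (by decide +kernel))

set_option maxHeartbeats 400000 in
/-- `D = -7352`: the odd character `χ₈·(·/919)` of conductor `7352` (`919`: prime) — Fekete–Pólya witness of order `3` along the induced modulus `7352·35 = 257320`, block certificate (digits of `44` bits, splitting depth `9`); est. `2.5` kernel-s. [cite: MontgomeryVaughan2007, §11.2.1 Exercises 7 (g), 8] -/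
theorem noRealZeroOdd_fp_7352 :
    ∀ χ : DirichletCharacter ℂ 7352, χ.IsQuadratic → χ.IsPrimitive → χ.Odd →
      ∀ σ : ℝ, 0 < σ → σ < 1 → χ.LFunction σ ≠ 0 :=
  good_odd_of_eight_blk [919] (by norm_num) (by decide) (by decide) 35 3 44 9 (by decide) (by decide) (by decide)
    (Or.inl (by decide +kernel)) (Or.inr (by decide +kernel))

set_option maxHeartbeats 400000 in
/-- `D = 7377`: the even character `(·/7377)` of conductor `7377` (`7377`: 3 · 2459) — Fekete–Pólya witness of order `3` along the induced modulus `7377·35 = 258195`, block certificate (digits of `41` bits, splitting depth `9`); est. `2.5` kernel-s. [cite: MontgomeryVaughan2007, §11.2.1 Exercises 7 (g), 8] -/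
theorem noRealZeroEven_fp_7377 :
    ∀ χ : DirichletCharacter ℂ 7377, χ.IsQuadratic → χ.IsPrimitive → χ.Even →
      ∀ σ : ℝ, 0 < σ → σ < 1 → χ.LFunction σ ≠ 0 :=
  good_even_of_odd_blk [3, 2459] (by norm_num) (by decide) (by decide) 35 3 41 9 (by decide) (by decide) (by decide)
    (Or.inr (by decide +kernel))

set_option maxHeartbeats 400000 in
/-- `D = 7388`: the even character `χ₋₄·(·/1847)` of conductor `7388` (`1847`: prime) — Fekete–Pólya witness of order `7` along the induced modulus `7388·15 = 110820`, block certificate (digits of `98` bits, splitting depth `9`); est. `4.0` kernel-s. [cite: MontgomeryVaughan2007, §11.2.1 Exercises 7 (g), 8] -/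
theorem noRealZeroEven_fp_7388 :
    ∀ χ : DirichletCharacter ℂ 7388, χ.IsQuadratic → χ.IsPrimitive → χ.Even →
      ∀ σ : ℝ, 0 < σ → σ < 1 → χ.LFunction σ ≠ 0 :=
  good_even_of_four_blk [1847] (by norm_num) (by decide) (by decide) 15 7 98 9 (by decide) (by decide) (by decide)
    (Or.inr (by decide +kernel))

set_option maxHeartbeats 400000 in
/-- `D = -7555`: the odd character `(·/7555)` of conductor `7555` (`7555`: 5 · 1511) — Fekete–Pólya witness of order `6` along the induced modulus `7555·21 = 158655`, block certificate (digits of `87` bits, splitting depth `10`); est. `4.7` kernel-s. [cite: MontgomeryVaughan2007, §11.2.1 Exercises 7 (g), 8] -/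
theorem noRealZeroOdd_fp_7555 :
    ∀ χ : DirichletCharacter ℂ 7555, χ.IsQuadratic → χ.IsPrimitive → χ.Odd →
      ∀ σ : ℝ, 0 < σ → σ < 1 → χ.LFunction σ ≠ 0 :=
  good_odd_of_odd_blk [5, 1511] (by norm_num) (by decide) (by decide) 21 6 87 10 (by decide) (by decide) (by decide)
    (Or.inr (by decide +kernel))

set_option maxHeartbeats 400000 in
/-- `D = -7687`: the odd character `(·/7687)` of conductor `7687` (`7687`: prime) — Fekete–Pólya witness of order `8` along the induced modulus `7687·35 = 269045`, block certificate (digits of `123` bits, splitting depth `11`); est. `12.5` kernel-s. [cite: MontgomeryVaughan2007, §11.2.1 Exercises 7 (g), 8] -/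
theorem noRealZeroOdd_fp_7687 :
    ∀ χ : DirichletCharacter ℂ 7687, χ.IsQuadratic → χ.IsPrimitive → χ.Odd →
      ∀ σ : ℝ, 0 < σ → σ < 1 → χ.LFunction σ ≠ 0 :=
  good_odd_of_odd_blk [7687] (by norm_num) (by decide) (by decide) 35 8 123 11 (by decide) (by decide) (by decide)
    (Or.inr (by decide +kernel))

end Literature.NumberTheory.LFunctions
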